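import Summits.AnomalousDissipation.AnomalousDissipation.Theorems.EnsembleRigidityGPMeanBoundedFamilyStubHeadPinned
import Summits.AnomalousDissipation.AnomalousDissipation.Theorems.EnsembleRigidityGPMeanBoundedFamilyStubSymmetricScheme
import Summits.AnomalousDissipation.AnomalousDissipation.Theorems.EnsembleRigidityGPMeanBoundedFamilyStubHeadCoefficients
import Summits.AnomalousDissipation.AnomalousDissipation.Theorems.TaylorCertificatesSteadyStatesLoudBoundedStubGpAdmissible
import Literature.Analysis.FunctionSpaces.TorusTrigPoly
import Literature.Analysis.FunctionSpaces.TorusFourierModes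
import Literature.Analysis.FunctionSpaces.TorusTruncationH1

/-!
# Stub `stub_shellOnePinningGP` (S3) of line `Sketch` (crux stmt-AnomalousDissipation-15151,
  `VirtualDissipation.LightSteadyStatesGP`)

PINNING of the forcing shell in the symmetry class of the Galloway–Proctor force `f_GP = gpForce`:
for every smooth solenoidal mean-zero `G`-symmetric field `u` on `T³` (`IsGPSymmetric`, the
stabiliser `G` of `f_GP`, order 24), the Fourier truncation to `|k|² ≤ 1` is
`P₁u = Torus.fourierTruncate 1 u = (2/3)(f_GP, u)_{L²} · f_GP`.

Proof: `v = P₁u` is smooth, divergence free (transversal coefficients), mean zero, band-limited to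
`|k|² ≤ 1`, and `G`-symmetric — symmetry of a continuous field is a twisted covariance relation
among its Fourier coefficients (`StubSymmetricScheme.mFourierCoeff_of_symmetric` /
`symmetric_of_mFourierCoeff`), and the ball `|k|² ≤ N²` is stable under signed coordinate
permutations (`freqNormSq_signedPerm`). The landed `stub_headPinned`
(`Fix(G) ∩ {|k|² ≤ 1} = ℝ f_GP`) gives `v = c f_GP`; pairing with `f_GP`, which is band-limited to
`|k|² = 1` (`∫⟪P₁u, f_GP⟫ = ∫⟪u, f_GP⟫`, `Torus.integral_inner_fourierTruncate_eq`) and has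
`∫‖f_GP‖² = 3/2`, gives `c = (2/3)(f_GP, u)`.
-/

noncomputable section

-- every `Summit.AnomalousDissipation.AnomalousDissipation.…` name repeats the summit = sub-problem segment (D-0017 layout)
set_option linter.dupNamespace false

namespace Summit.AnomalousDissipation.AnomalousDissipation.Theorems.VirtualDissipation.LightSteadyStatesGP

open MeasureTheory Filter Topology UnitAddTorus
open scoped InnerProductSpace ENNReal
open Literature.Analysis.FunctionSpaces Literature.Analysis.FluidPDE
open Summit.AnomalousDissipation.AnomalousDissipation.Theorems.EnsembleRigidity

namespace StubShellOnePinning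

open GPMeanBoundedFamily

/-! ## Truncations of symmetric fields are symmetric -/

/-- **Fourier truncation commutes with affine lattice symmetries.** If a continuous field
`u : T³ → ℝ³` is covariant under the affine map `A y = (ε_j y_{σ j} + b_j)_j` (`σ` a coordinate
permutation, `ε_j = ±1`), `u (A y) i = ε_i u y (σ i)`, then so is every truncation `P_N u`: the
covariance is the twisted relation `û(Qk) i = e_{-Qk}(b) ε_i û(k) (σ i)` on Fourier coefficients,
`(Qk)_j = ε_j k_{σ j}`, and the ball `|k|² ≤ N²` is `Q`-stable (`|Qk|² = |k|²`). [folklore] -/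
theorem symm_fourierTruncate (σ : Equiv.Perm (Fin 3)) {ε : Fin 3 → ℤ}
    (hε : ∀ j, ε j = 1 ∨ ε j = -1) (b : UnitAddTorus (Fin 3))
    {u : UnitAddTorus (Fin 3) → EuclideanSpace ℝ (Fin 3)} (hu : Continuous u)
    (hsym : ∀ (y : UnitAddTorus (Fin 3)) (i : Fin 3),
      u (fun j => ε j • y (σ j) + b j) i = (ε i : ℝ) * u y (σ i))
    (N : ℕ) (y : UnitAddTorus (Fin 3)) (i : Fin 3) :
    Torus.fourierTruncate N u (fun j => ε j • y (σ j) + b j) i =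
      (ε i : ℝ) * Torus.fourierTruncate N u y (σ i) := by
  have hint : Integrable u volume := hu.integrable_unitAddTorus
  have hQ : ∀ k : Fin 3 → ℤ,
      (fun j => ε j * k (σ j)) ∈ Torus.freqBall N ↔ k ∈ Torus.freqBall N := fun k => by
    rw [Torus.mem_freqBall, Torus.mem_freqBall,
      StubSymmetricScheme.freqNormSq_signedPerm σ hε (Q := fun k j => ε j * k (σ j))
        (fun _ _ => rfl) k]
  refine StubSymmetricScheme.symmetric_of_mFourierCoeff σ hε (Q := fun k j => ε j * k (σ j))
    (fun _ _ => rfl) b (Torus.continuous_fourierTruncate N u) (fun k i => ?_) y i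
  rw [Torus.mFourierCoeff_fourierTruncate hint, Torus.mFourierCoeff_fourierTruncate hint]
  by_cases hk : k ∈ Torus.freqBall N
  · rw [if_pos ((hQ k).2 hk), if_pos hk]
    exact StubSymmetricScheme.mFourierCoeff_of_symmetric σ hε (Q := fun k j => ε j * k (σ j))
      (fun _ _ => rfl) b hu hsym k i
  · rw [if_neg (fun h => hk ((hQ k).1 h)), if_neg hk]
    simp

/-- **Truncations of `G`-symmetric fields are `G`-symmetric**: `IsGPSymmetric u` for continuous
`u` implies `IsGPSymmetric (P_N u)` (the three generators of `G` are affine lattice symmetries,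
`StubSymmetricScheme.isGPSymmetric_iff`, and `symm_fourierTruncate`). [folklore] -/
theorem isGPSymmetric_fourierTruncate {u : UnitAddTorus (Fin 3) → EuclideanSpace ℝ (Fin 3)}
    (hu : Continuous u) (hsym : IsGPSymmetric u) (N : ℕ) :
    IsGPSymmetric (Torus.fourierTruncate N u) := by
  rw [StubSymmetricScheme.isGPSymmetric_iff] at hsym ⊢
  have hG : ∀ p ∈ ([(Equiv.addRight 1, fun _ => 1, 0), (Equiv.refl _, fun _ => -1, 0),
      (Equiv.refl _, ![1, -1, -1], ![halfPeriod, 0, halfPeriod])] :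
        List (Equiv.Perm (Fin 3) × (Fin 3 → ℤ) × UnitAddTorus (Fin 3))),
      ∀ j, p.2.1 j = 1 ∨ p.2.1 j = -1 := by
    simp only [List.mem_cons, List.not_mem_nil, or_false, forall_eq_or_imp, forall_eq]
    exact ⟨fun _ => by simp, fun _ => by simp, fun j => by fin_cases j <;> simp⟩
  intro p hp
  exact symm_fourierTruncate p.1 (hG p hp) p.2.2 hu (hsym p hp) N

/-! ## The Galloway–Proctor force is band-limited to the first shell -/

/-- A Galloway–Proctor mode `sin(2π x_j) e_i` has no Fourier modes beyond the first shell: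
`𝓕(sin(2πx_j) e_i)(k) = 0` for `|k|² > 1` (a single real mode at the frequency `e_j`, `|e_j|² = 1`).
[folklore] -/
theorem mFourierCoeff_gpMode_eq_zero (j i : Fin 3) {k : Fin 3 → ℤ}
    (hk : (1 : ℝ) < Torus.freqNormSq k) :
    mFourierCoeff (EuclideanSpace.complexify ∘
      ⇑(Torus.stokesMode (Pi.single j (1 : ℤ)) (EuclideanSpace.single i (1 : ℝ)) false)) k = 0 := by
  rw [Torus.stokesMode_eq_realTrigPoly]
  refine Torus.mFourierCoeff_realTrigPoly_singleton_eq_zero _ _ ?_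
  have h1 : Torus.freqNormSq (Pi.single j (1 : ℤ) : Fin 3 → ℤ) = 1 := by
    fin_cases j <;> simp [Torus.freqNormSq, Pi.single_apply]
  rwa [h1]

/-- **`f_GP` is band-limited to `|k|² ≤ 1`**: `𝓕(f_GP)(k) = 0` off the frequency ball of radius `1`
(`f_GP` is the sum of three sine modes at the frequencies `e₂, e₀, e₁`). [folklore] -/
theorem mFourierCoeff_gpForce_eq_zero {k : Fin 3 → ℤ} (hk : k ∉ Torus.freqBall 1) :
    mFourierCoeff (EuclideanSpace.complexify ∘ gpForce) k = 0 := by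
  have hk' : (1 : ℝ) < Torus.freqNormSq k := by
    have h := Torus.not_mem_freqBall.1 hk
    simpa using h
  have hI : ∀ j i : Fin 3, Integrable (EuclideanSpace.complexify ∘
      ⇑(Torus.stokesMode (Pi.single j (1 : ℤ)) (EuclideanSpace.single i (1 : ℝ)) false)) volume :=
    fun j i => Torus.integrable_complexify_comp (Torus.isSmooth_stokesMode _ _ _).integrable
  have hg : EuclideanSpace.complexify ∘ gpForce =
      (EuclideanSpace.complexify ∘
          ⇑(Torus.stokesMode (Pi.single (2 : Fin 3) (1 : ℤ))
            (EuclideanSpace.single (0 : Fin 3) (1 : ℝ)) false) +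
        EuclideanSpace.complexify ∘
          ⇑(Torus.stokesMode (Pi.single (0 : Fin 3) (1 : ℤ))
            (EuclideanSpace.single (1 : Fin 3) (1 : ℝ)) false)) +
      EuclideanSpace.complexify ∘
          ⇑(Torus.stokesMode (Pi.single (1 : Fin 3) (1 : ℤ))
            (EuclideanSpace.single (2 : Fin 3) (1 : ℝ)) false) := by
    funext x
    simp only [Function.comp_apply, Pi.add_apply, gpForce, map_add]
  rw [hg, Torus.mFourierCoeff_add ((hI 2 0).add (hI 0 1)) (hI 1 2),
    Torus.mFourierCoeff_add (hI 2 0) (hI 0 1), mFourierCoeff_gpMode_eq_zero 2 0 hk',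
    mFourierCoeff_gpMode_eq_zero 0 1 hk', mFourierCoeff_gpMode_eq_zero 1 2 hk', add_zero, add_zero]

/-! ## The truncation `P₁u` of an admissible symmetric field -/

/-- **`P₁u` lies on the line `ℝ f_GP`**: for a smooth solenoidal mean-zero `G`-symmetric `u`,
`P₁u = c f_GP` for some `c` — `P₁u` is smooth, solenoidal (transversal coefficients), mean zero,
its own truncation and `G`-symmetric, so the landed `stub_headPinned` applies. [folklore] -/
theorem exists_fourierTruncate_one_eq_smul {u : UnitAddTorus (Fin 3) → EuclideanSpace ℝ (Fin 3)}
    (hs : Torus.IsSmooth u) (hdiv : Torus.IsDivFree u) (hmean : Torus.HasZeroMean u)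
    (hsym : IsGPSymmetric u) : ∃ c : ℝ, Torus.fourierTruncate 1 u = c • gpForce := by
  have hint : Integrable u volume := hs.integrable
  have hvs : Torus.IsSmooth (Torus.fourierTruncate 1 u) := Torus.isSmooth_fourierTruncate 1 u
  have hvd : Torus.IsDivFree (Torus.fourierTruncate 1 u) :=
    Torus.isDivFree_realTrigPoly (hdiv.isTransversal_mFourierCoeff hs (Torus.freqBall 1))
  have hvm : Torus.HasZeroMean (Torus.fourierTruncate 1 u) :=
    Torus.hasZeroMean_fourierTruncate hint hmean 1
  have hvt : Torus.fourierTruncate 1 (Torus.fourierTruncate 1 u) = Torus.fourierTruncate 1 u :=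
    Torus.fourierTruncate_eq_self (Torus.continuous_fourierTruncate 1 u) fun k hk => by
      rw [Torus.mFourierCoeff_fourierTruncate hint, if_neg (Torus.not_mem_freqBall.2 hk)]
  have hvsym : IsGPSymmetric (Torus.fourierTruncate 1 u) :=
    isGPSymmetric_fourierTruncate hs.continuous hsym 1
  exact stub_headPinned.1 _ hvs hvd hvm hvt hvsym

end StubShellOnePinning

/-- **S3 `stub_shellOnePinningGP`** — PINNING of the forcing shell: for a smooth solenoidal mean-zero
`G`-symmetric field `u`, the projection onto `|k|² ≤ 1` is `P₁u = (2/3)(f_GP, u)·f_GP`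
(`Fix(G) ∩ shell 1 = ℝ f_GP`: the landed `stub_headPinned` applied to `P₁u = fourierTruncate 1 u`,
which is smooth, solenoidal, mean-zero, band-limited and `G`-symmetric — symmetry is a property of the
Fourier coefficients, `isGPSymmetric_iff`; the constant by pairing with `f_GP`, `∫⟪f_GP, P₁u⟫ = ∫⟪f_GP, u⟫`
and `∫|f_GP|² = 3/2`). [folklore] -/
theorem stub_shellOnePinningGP :
    ∀ u : UnitAddTorus (Fin 3) → EuclideanSpace ℝ (Fin 3), Torus.IsSmooth u → Torus.IsDivFree u →
      Torus.HasZeroMean u → IsGPSymmetric u →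
      Torus.fourierTruncate 1 u = ((2 : ℝ) / 3 * ∫ x, ⟪gpForce x, u x⟫_ℝ) • gpForce := by
  intro u hs hdiv hmean hsym
  obtain ⟨c, hc⟩ := StubShellOnePinning.exists_fourierTruncate_one_eq_smul hs hdiv hmean hsym
  have hfs : Torus.IsSmooth gpForce := SteadyStatesLoudBounded.GpAdmissible.stub_gpAdmissible.1
  -- `∫⟪P₁u, f_GP⟫ = ∫⟪u, f_GP⟫` (`f_GP` band-limited) and `∫⟪c f_GP, f_GP⟫ = c · 3/2`
  have h1 : ∫ x, ⟪Torus.fourierTruncate 1 u x, gpForce x⟫_ℝ = ∫ x, ⟪u x, gpForce x⟫_ℝ :=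
    Torus.integral_inner_fourierTruncate_eq (hs.memLp 2) (hfs.memLp 2)
      fun k hk => StubShellOnePinning.mFourierCoeff_gpForce_eq_zero hk
  have h2 : ∫ x, ⟪Torus.fourierTruncate 1 u x, gpForce x⟫_ℝ = c * (3 / 2) := by
    rw [hc]
    simp only [Pi.smul_apply, real_inner_smul_left, real_inner_self_eq_norm_sq]
    rw [integral_const_mul, GPMeanBoundedFamily.StubHeadCoefficients.integral_norm_sq_gpForce]
  have h3 : ∫ x, ⟪gpForce x, u x⟫_ℝ = ∫ x, ⟪u x, gpForce x⟫_ℝ :=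
    integral_congr_ae (ae_of_all _ fun x => real_inner_comm _ _)
  have key : c = (2 : ℝ) / 3 * ∫ x, ⟪gpForce x, u x⟫_ℝ := by
    rw [h3, ← h1, h2]; ring
  rw [← key]
  exact hc

end Summit.AnomalousDissipation.AnomalousDissipation.Theorems.VirtualDissipation.LightSteadyStatesGP

end
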